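import Literature.Probability.Percolation.KozmaNitzanTheorem6
import Summits.CriticalPhenomena.PercolationContinuityZ3.Theorems.PercNearOneGluingKNSlabBridgeOfThm6
import HarnessLib

/-!
# `PercNearOneGluing.KNSlabBridge` (stmt-CriticalPhenomena-10357) — PROVED, unconditionally

The bridge `KNSlabBridge` of route `PercNearOneGluing` (sub-problem `PercolationContinuityZ3`) —
"Conjecture 3 of Kozma–Nitzan and `θ_{ℤ³}(p) > 0` give a slab `ℤ² × {0,…,k}` in which the origin
percolates at `p`" — is Theorem 6 of G. Kozma, S. Nitzan, *A reduction of the `θ(p_c) = 0` problem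
to a conjectured inequality*, arXiv:2401.12397 (2024), §4 pp. 25–31, at `d = 3`, in the slab form
its proof delivers. It is now a theorem of the tree: the whole of §4 of the paper (Lemmas 7–12, the
target lemma, the exploration process and its analysis) is formalised in
`Literature/Probability/Percolation/KozmaNitzan*.lean`, ending with
`Literature.Probability.Percolation.KozmaNitzan.exists_slab_theta_pos`; the logical reduction
`KNSlabBridge_of_slab` of the companion helper file turns it into the route's declaration.

## References

* G. Kozma, S. Nitzan, arXiv:2401.12397 (2024), §4 Theorem 6 [KozmaNitzan2024].
-/

namespace Summit.CriticalPhenomena.PercolationContinuityZ3.Theorems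

open Literature.Probability.Percolation

/-- **`KNSlabBridge` holds** (Kozma–Nitzan 2024, Theorem 6 at `d = 3`): assuming Conjecture 3, for
every `p` with `θ_{ℤ³}(p) > 0` there is `k > 0` with `θ_{slabGraph 3 k}(slabOrigin 3 k)(p) > 0`.
[cite: KozmaNitzan2024, §4 Theorem 6 (pp. 25–31)] -/
theorem KNSlabBridge_proof :
    Summit.CriticalPhenomena.PercolationContinuityZ3.Theses.PercNearOneGluing.KNSlabBridge :=
  KNSlabBridge_of_slab fun hC p hp0 hp1 hθ => KozmaNitzan.exists_slab_theta_pos hC p hp0 hp1 hθ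

end Summit.CriticalPhenomena.PercolationContinuityZ3.Theorems
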